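import Literature.AlgebraicGeometry.RealAlgebraic.ComplexOrientationFormula
import Literature.AlgebraicGeometry.RealAlgebraic.RealLocusOvals
import Literature.AlgebraicGeometry.RealAlgebraic.TwoHalves
import Literature.NumberTheory.Transcendental.ZeroLocusConnectedProofs
import HarnessLib

/-!
# Complex orientations of a dividing plane curve are well defined: proof of
# `complexOrientationSign_isUnit_of_isDividing`

Topic `Literature/AlgebraicGeometry/RealAlgebraic`. Discharge of the named fact
`complexOrientationSign_isUnit_of_isDividing` of `ComplexOrientationFormula.lean` (Rokhlin 1974,
§2; Degtyarev–Kharlamov 2000, §1): for `p ∈ ℚ[x, y]` with compact real zero locus, nonsingular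
complex affine curve `A`, geometrically irreducible and dividing, every half `H` and every oval
`O`, the sign `complexOrientationSign p H O ∈ {+1, -1}` — the complex orientation of `O` induced
from `H` is defined and is either the counter-clockwise or the clockwise one.
**Everything here is proved; no definition and no named fact is introduced.**

Proof (following Rokhlin's description of the local picture, with the tree's infrastructure):

* `A` is connected: `p` irreducible over `ℂ` generates a prime ideal of `ℂ[x, y]`, and
  `V(𝔭) ⊆ ℂ²` is connected for `𝔭` prime (Shafarevich VII §2 Thm. 7.1, the tree's
  `Literature.NumberTheory.Transcendental.isConnected_zeroLocus_of_isPrime_holds`);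
* the two halves: `A ∖ ℝA = H ⊔ conj H` (`TwoHalves.lean`), so at a real point the two half-discs
  `ψ(D⁺)`, `ψ(D⁻)` of a real chart (`PlaneCurveLocalCharts.lean`) lie one in `H` and one in
  `conj H`; with the sign of the pairing `⟪Im w, J∇p⟫` on them (`chart_sign`) this gives
  `halfSideSign p H v = ±1`, the same value at all real points of one chart, hence a locally
  constant function on the real locus (`halfSideSign_locallyConstant`);
* the ovals are smooth Jordan curves with the gradient pointing out of the inside along the whole
  oval or into it along the whole oval (`RealLocusOvals.lean`,
  `gradOutwardSign_eq_one_or_eq_neg_one_on_oval`);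
* ovals are connected, so the product `complexOrientationSignAt = halfSideSign · gradOutwardSign`
  is a constant `±1` along each oval, which is `complexOrientationSign`.

## References

* [Rokhlin1974] V. A. Rokhlin, Complex orientations of real algebraic curves, Funct. Anal. Appl.
  8 (1974) 331–334, §2.
* [DegtyarevKharlamov2000] A. Degtyarev, V. Kharlamov, Topological properties of real algebraic
  varieties: du côté de chez Rokhlin, Russian Math. Surveys 55 (2000), arXiv:math/0004134, §1
  (read: arXiv text p. 2, "the complex conjugation interchanges `A±` and the complex orientation
  of `A±` induces two opposite orientations on `ℝA`, called its complex orientations").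
* I. R. Shafarevich, Basic Algebraic Geometry 2 (1994), Book 3, Ch. VII §2, Thm. 7.1.
-/

noncomputable section

open MvPolynomial Set Filter Metric
open scoped _root_.Topology _root_.ComplexConjugate

namespace Literature.AlgebraicGeometry.RealAlgebraic

section General

variable {R : Type*} [CommSemiring R] [Algebra R ℂ] [Algebra R ℝ] [IsScalarTower R ℝ ℂ]
variable (p : MvPolynomial (Fin 2) R)

/-! ### The side sign from a local description -/

omit [Algebra R ℝ] [IsScalarTower R ℝ ℂ] in
/-- **`halfSideSign = +1` from a local description.** If near the real point `v` the non-real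
locus splits into `S₊ ∪ S₋` with the pairing `⟪Im w, J∇p(v)⟫` positive on `S₊` and negative on
`S₋`, `S₊ ⊆ H`, `S₋ ∩ H = ∅`, and `v` adherent to `S₊`, then `halfSideSign p H v = 1`. [folklore] -/
theorem halfSideSign_eq_one_of_sides {H N Sp Sn : Set (Fin 2 → ℂ)} {v : Fin 2 → ℝ}
    (hN : IsOpen N) (hvN : (fun j => (v j : ℂ)) ∈ N)
    (hcover : nonRealLocus p ∩ N ⊆ Sp ∪ Sn)
    (hpos : ∀ w ∈ Sp, 0 < imPairing (posTangent p v) w)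
    (hneg : ∀ w ∈ Sn, imPairing (posTangent p v) w < 0)
    (hSp : Sp ⊆ nonRealLocus p) (hH : Sp ⊆ H) (hH' : Disjoint Sn H)
    (hcl : (fun j => (v j : ℂ)) ∈ closure Sp) : halfSideSign p H v = 1 := by
  classical
  have c1 : ∀ᶠ w in 𝓝[nonRealLocus p] (fun j => (v j : ℂ)),
      w ∈ H ↔ 0 < imPairing (posTangent p v) w := by
    rw [eventually_nhdsWithin_iff]
    filter_upwards [hN.mem_nhds hvN] with w hwN hwNR
    rcases hcover ⟨hwNR, hwN⟩ with hw | hw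
    · exact iff_of_true (hH hw) (hpos w hw)
    · exact iff_of_false (fun h => Set.disjoint_left.1 hH' hw h) (not_lt.2 (hneg w hw).le)
  have c2 : ¬ ∀ᶠ w in 𝓝[nonRealLocus p] (fun j => (v j : ℂ)),
      w ∈ H ↔ imPairing (posTangent p v) w < 0 := by
    intro h
    rw [eventually_nhdsWithin_iff] at h
    obtain ⟨w, hw, hwSp⟩ := mem_closure_iff_nhds.1 hcl _ h
    have := (hw (hSp hwSp)).1 (hH hwSp)
    exact lt_asymm this (hpos w hwSp)
  unfold halfSideSign
  rw [if_pos c1, if_neg c2]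
  norm_num

omit [Algebra R ℝ] [IsScalarTower R ℝ ℂ] in
/-- **`halfSideSign = -1` from a local description** (mirror statement). [folklore] -/
theorem halfSideSign_eq_neg_one_of_sides {H N Sp Sn : Set (Fin 2 → ℂ)} {v : Fin 2 → ℝ}
    (hN : IsOpen N) (hvN : (fun j => (v j : ℂ)) ∈ N)
    (hcover : nonRealLocus p ∩ N ⊆ Sp ∪ Sn)
    (hpos : ∀ w ∈ Sp, 0 < imPairing (posTangent p v) w)
    (hneg : ∀ w ∈ Sn, imPairing (posTangent p v) w < 0)
    (hSn : Sn ⊆ nonRealLocus p) (hH : Disjoint Sp H) (hH' : Sn ⊆ H)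
    (hcl : (fun j => (v j : ℂ)) ∈ closure Sn) : halfSideSign p H v = -1 := by
  classical
  have c1 : ¬ ∀ᶠ w in 𝓝[nonRealLocus p] (fun j => (v j : ℂ)),
      w ∈ H ↔ 0 < imPairing (posTangent p v) w := by
    intro h
    rw [eventually_nhdsWithin_iff] at h
    obtain ⟨w, hw, hwSn⟩ := mem_closure_iff_nhds.1 hcl _ h
    have := (hw (hSn hwSn)).1 (hH' hwSn)
    exact lt_asymm this (hneg w hwSn)
  have c2 : ∀ᶠ w in 𝓝[nonRealLocus p] (fun j => (v j : ℂ)),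
      w ∈ H ↔ imPairing (posTangent p v) w < 0 := by
    rw [eventually_nhdsWithin_iff]
    filter_upwards [hN.mem_nhds hvN] with w hwN hwNR
    rcases hcover ⟨hwNR, hwN⟩ with hw | hw
    · exact iff_of_false (fun h => Set.disjoint_left.1 hH hw h) (not_lt.2 (hpos w hw).le)
    · exact iff_of_true (hH' hw) (hneg w hw)
  unfold halfSideSign
  rw [if_neg c1, if_pos c2]
  norm_num

/-! ### `halfSideSign` is `±1` and locally constant on the real locus -/

/-- **The side sign is `±1`, locally constantly, on a dividing connected nonsingular curve.**
For every half `H` and real zero `v` there are `c ∈ {1, -1}` and an open `W ∋ v` with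
`halfSideSign p H v' = c` for all real zeros `v' ∈ W`: in a real chart at `v` (free coordinate
`k`) the two half-discs lie one in `H`, one in `conj H` (`IsHalf.subset_or_disjoint_of_image_star`),
and at every real point `ψ(s)` of the chart the pairing has the sign of `κ Im t`
(`chart_sign`). [cite: Rokhlin1974, §2] -/
theorem halfSideSign_locallyConstant (hA : IsPreconnected (complexZeroLocus p))
    (hsm : ∀ w ∈ complexZeroLocus p, ∃ i, aeval w (pderiv i p) ≠ 0) (hdiv : IsDividing p)
    {H : Set (Fin 2 → ℂ)} (hH : IsHalf p H) {v : Fin 2 → ℝ} (hv : aeval v p = 0) :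
    ∃ c : ℤ, (c = 1 ∨ c = -1) ∧ ∃ W : Set (Fin 2 → ℝ), IsOpen W ∧ v ∈ W ∧
      ∀ v' ∈ W, aeval v' p = 0 → halfSideSign p H v' = c := by
  -- the real chart at `v`
  have hvA : (fun j => (v j : ℂ)) ∈ complexZeroLocus p := (ofReal_mem_complexZeroLocus_iff p v).2 hv
  obtain ⟨l, hl⟩ := hsm _ hvA
  rw [aeval_ofReal, Complex.ofReal_ne_zero] at hl
  obtain ⟨k, hkl⟩ : ∃ k : Fin 2, k ≠ l := ⟨l + 1, by fin_cases l <;> decide⟩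
  obtain ⟨Ω, r, ψ, hΩ, hvΩ, hr, hψa, hψ, huniq⟩ := exists_realChart_aux p v hv hkl hl
  set κ : ℝ := -(if k = 0 then 1 else -1 : ℝ) * aeval v (pderiv l p) with hκ
  have hκ0 : κ ≠ 0 := by
    rw [hκ]
    refine mul_ne_zero (neg_ne_zero.2 ?_) hl
    split_ifs <;> norm_num
  have hψ4 : ∀ t ∈ ball ((v k : ℂ)) r, ψ t ∈ Ω ∧ aeval (ψ t) p = 0 ∧ ψ t k = t ∧
      ψ (conj t) = star (ψ t) := fun t ht =>
    ⟨(hψ t ht).1, (hψ t ht).2.1, (hψ t ht).2.2.1, (hψ t ht).2.2.2.1⟩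
  obtain ⟨hUp, hUn, hUpc, -, hsUp, -, -, hcl⟩ := realChart_halfDiscs p
    (fun t ht => (hψa t ht).continuousAt) hψ4 huniq hκ0
  set Up := ψ '' {t ∈ ball ((v k : ℂ)) r | 0 < κ * t.im} with hUpdef
  set Un := ψ '' {t ∈ ball ((v k : ℂ)) r | κ * t.im < 0} with hUndef
  -- `Up` is nonempty: `v` itself is adherent to `Up ∪ Un = Up ∪ conj Up`
  have hUpne : Up.Nonempty := by
    have hvcl : (fun j => (v j : ℂ)) ∈ closure (Up ∪ Un) := hcl ⟨hvA, hvΩ, mem_ball_self hr⟩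
    by_contra hne
    rw [not_nonempty_iff_eq_empty] at hne
    rw [← hsUp, hne, image_empty, union_self, closure_empty] at hvcl
    exact hvcl
  -- the two half-discs lie on the two sides of `H`
  have hsides := hH.subset_or_disjoint_of_image_star hA hsm hdiv hUpc hUp hUpne
  rw [hsUp] at hsides
  -- the neighbourhood of real points covered by the chart
  set W : Set (Fin 2 → ℝ) := {v' | (fun j => (v' j : ℂ)) ∈ Ω ∧ (v' k : ℂ) ∈ ball ((v k : ℂ)) r}
    with hW
  have hι : Continuous fun v' : Fin 2 → ℝ => fun j => (v' j : ℂ) :=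
    continuous_pi fun j => Complex.continuous_ofReal.comp (continuous_apply j)
  have hWo : IsOpen W := (hΩ.preimage hι).inter
    (isOpen_ball.preimage (Complex.continuous_ofReal.comp (continuous_apply k)))
  have hvW : v ∈ W := ⟨hvΩ, mem_ball_self hr⟩
  -- the value of `halfSideSign` at a real zero `v' ∈ W`
  have hval : ∀ v' ∈ W, aeval v' p = 0 →
      (Up ⊆ H ∧ Disjoint Un H → halfSideSign p H v' = 1) ∧
      (Disjoint Up H ∧ Un ⊆ H → halfSideSign p H v' = -1) := by
    intro v' hv'W hv'
    obtain ⟨hv'Ω, hv'k⟩ := hv'W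
    set s : ℝ := v' k with hs
    have hzA : aeval (fun j => (v' j : ℂ)) p = 0 := (ofReal_mem_complexZeroLocus_iff p v').2 hv'
    have hψs : ψ (s : ℂ) = fun j => (v' j : ℂ) := huniq _ hv'Ω hzA
    have hv'eq : (fun j => (ψ (s : ℂ) j).re) = v' := by
      funext j
      simp only [hψs, Complex.ofReal_re]
    -- the sign of the pairing near `ψ s`
    obtain ⟨ρ, hρ, hballρ, hsign⟩ := chart_sign p hkl hψa
      (fun t ht => ⟨(hψ t ht).2.1, (hψ t ht).2.2.1, (hψ t ht).2.2.2.1, (hψ t ht).2.2.2.2⟩) hv'k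
    rw [hv'eq] at hsign
    -- the local half-discs at `s`
    have hψ4' : ∀ t ∈ ball ((v' k : ℂ)) ρ, ψ t ∈ Ω ∧ aeval (ψ t) p = 0 ∧ ψ t k = t ∧
        ψ (conj t) = star (ψ t) := fun t ht => hψ4 t (hballρ ht)
    obtain ⟨hSp, hSn, -, -, -, -, hcover, -⟩ := realChart_halfDiscs p
      (fun t ht => (hψa t (hballρ ht)).continuousAt) hψ4' huniq hκ0
    set Sp := ψ '' {t ∈ ball ((v' k : ℂ)) ρ | 0 < κ * t.im} with hSpdef
    set Sn := ψ '' {t ∈ ball ((v' k : ℂ)) ρ | κ * t.im < 0} with hSndef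
    have hSpUp : Sp ⊆ Up := image_mono fun t ht => ⟨hballρ ht.1, ht.2⟩
    have hSnUn : Sn ⊆ Un := image_mono fun t ht => ⟨hballρ ht.1, ht.2⟩
    have hNo : IsOpen (Ω ∩ {z : Fin 2 → ℂ | z k ∈ ball ((v' k : ℂ)) ρ}) :=
      hΩ.inter (isOpen_ball.preimage (continuous_apply k))
    have hvN : (fun j => (v' j : ℂ)) ∈ Ω ∩ {z : Fin 2 → ℂ | z k ∈ ball ((v' k : ℂ)) ρ} :=
      ⟨hv'Ω, mem_ball_self hρ⟩
    have hposS : ∀ w ∈ Sp, 0 < imPairing (posTangent p v') w := by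
      rintro _ ⟨t, ht, rfl⟩; exact (hsign t ht.1).1.2 ht.2
    have hnegS : ∀ w ∈ Sn, imPairing (posTangent p v') w < 0 := by
      rintro _ ⟨t, ht, rfl⟩; exact (hsign t ht.1).2.2 ht.2
    -- `ψ s` is adherent to both local half-discs
    have hcws : ContinuousWithinAt ψ {t ∈ ball ((v' k : ℂ)) ρ | 0 < κ * t.im} (s : ℂ) :=
      (hψa _ hv'k).continuousAt.continuousWithinAt
    have hcws' : ContinuousWithinAt ψ {t ∈ ball ((v' k : ℂ)) ρ | κ * t.im < 0} (s : ℂ) :=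
      (hψa _ hv'k).continuousAt.continuousWithinAt
    have hclp : (fun j => (v' j : ℂ)) ∈ closure Sp := by
      rw [← hψs]
      exact hcws.mem_closure_image (ofReal_mem_closure_halfBall hκ0 s (mem_ball_self hρ))
    have hcln : (fun j => (v' j : ℂ)) ∈ closure Sn := by
      rw [← hψs]
      have h := ofReal_mem_closure_halfBall (neg_ne_zero.2 hκ0) s (c := ((v' k : ℝ) : ℂ)) (r := ρ)
        (mem_ball_self hρ)
      have hset : {t ∈ ball ((v' k : ℂ)) ρ | 0 < -κ * t.im} = {t ∈ ball ((v' k : ℂ)) ρ | κ * t.im < 0} := by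
        ext t; simp [neg_mul]
      rw [hset] at h
      exact hcws'.mem_closure_image h
    constructor
    · rintro ⟨hUpH, hUnH⟩
      exact halfSideSign_eq_one_of_sides p hNo hvN hcover hposS hnegS hSp (hSpUp.trans hUpH)
        (hUnH.mono_left hSnUn) hclp
    · rintro ⟨hUpH, hUnH⟩
      exact halfSideSign_eq_neg_one_of_sides p hNo hvN hcover hposS hnegS hSn (hUpH.mono_left hSpUp)
        (hSnUn.trans hUnH) hcln
  rcases hsides with hside | hside
  · exact ⟨1, Or.inl rfl, W, hWo, hvW, fun v' hv'W hv' => (hval v' hv'W hv').1 hside⟩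
  · exact ⟨-1, Or.inr rfl, W, hWo, hvW, fun v' hv'W hv' => (hval v' hv'W hv').2 hside⟩

end General

/-! ### The discharge -/

/-- An irreducible complex polynomial in two variables has a connected zero locus in `ℂ²`
(Shafarevich VII §2 Thm. 7.1 for the prime ideal it generates; the tree's
`Literature.NumberTheory.Transcendental.isConnected_zeroLocus_of_isPrime_holds`).
[cite: Shafarevich1994, Book 3 Ch. VII §2 Thm. 7.1] -/
theorem isConnected_complexZeroLocus_of_irreducible (p : MvPolynomial (Fin 2) ℚ)
    (hirr : Irreducible (map (algebraMap ℚ ℂ) p)) : IsConnected (complexZeroLocus p) := by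
  have hprime : (Ideal.span {map (algebraMap ℚ ℂ) p}).IsPrime := by
    rw [Ideal.span_singleton_prime hirr.ne_zero]
    exact hirr.prime
  have h := Literature.NumberTheory.Transcendental.isConnected_zeroLocus_of_isPrime_holds _ hprime
  convert h using 1
  ext w
  simp only [mem_complexZeroLocus_iff, MvPolynomial.zeroLocus, Set.mem_setOf_eq]
  constructor
  · intro hw q hq
    obtain ⟨r, rfl⟩ := Ideal.mem_span_singleton'.1 hq
    simp [map_mul, aeval_map_algebraMap, hw]
  · intro hw
    have := hw _ (Ideal.subset_span rfl)
    rwa [aeval_map_algebraMap] at this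

/-- **Complex orientations are well defined on a nonsingular dividing curve** — discharge of
the named fact `complexOrientationSign_isUnit_of_isDividing` (Rokhlin 1974, §2;
Degtyarev–Kharlamov 2000, §1): for `p ∈ ℚ[x, y]` with compact real zero locus, nonsingular
complex affine curve, geometrically irreducible and dividing, for every half `H` and every real
zero `v`, the sign `complexOrientationSign p H O` of the oval `O` through `v` is `+1` or `-1`.
Proof: `halfSideSign p H` is locally constant `±1` on the real locus
(`halfSideSign_locallyConstant`, using connectedness of the complex curve and Rokhlin's two
halves), `gradOutwardSign p O` is constant `±1` along the oval
(`gradOutwardSign_eq_one_or_eq_neg_one_on_oval`), the oval is connected, so their product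
`complexOrientationSignAt` is a constant `±1` along it. [cite: Rokhlin1974, §2] -/
theorem complexOrientationSign_isUnit_of_isDividing_holds :
    complexOrientationSign_isUnit_of_isDividing := by
  intro p hcpt hsm hirr hdiv H hH v hv
  have hA := isConnected_complexZeroLocus_of_irreducible p hirr
  set Z : Set (Fin 2 → ℝ) := {u | aeval u p = 0} with hZ
  set O := connectedComponentIn Z v with hO
  have hvO : v ∈ O := mem_connectedComponentIn hv
  have hOZ : O ⊆ Z := connectedComponentIn_subset _ _
  -- real regularity from complex nonsingularity
  have hreg : ∀ u : Fin 2 → ℝ, aeval u p = 0 → realGrad p u ≠ 0 := by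
    intro u hu h0
    obtain ⟨i, hi⟩ := hsm _ ((ofReal_mem_complexZeroLocus_iff p u).2 hu)
    apply hi
    rw [aeval_ofReal, ← realGrad_apply, h0, Pi.zero_apply, Complex.ofReal_zero]
  -- `halfSideSign` is a constant `±1` along `O`
  have hloc : ∀ v' ∈ O, ∀ᶠ u in 𝓝 v', u ∈ O → halfSideSign p H u = halfSideSign p H v' := by
    intro v' hv'
    obtain ⟨c, -, W, hWo, hv'W, hW⟩ :=
      halfSideSign_locallyConstant p hA.isPreconnected hsm hdiv hH (hOZ hv')
    filter_upwards [hWo.mem_nhds hv'W] with u huW huO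
    rw [hW u huW (hOZ huO), hW v' hv'W (hOZ hv')]
  have hhs : ∀ v' ∈ O, halfSideSign p H v' = halfSideSign p H v := fun v' hv' =>
    eq_of_eventually_eq_of_isPreconnected isPreconnected_connectedComponentIn hloc hv' hvO
  obtain ⟨c, hc, W, -, hvW, hW⟩ := halfSideSign_locallyConstant p hA.isPreconnected hsm hdiv hH hv
  have hcv : halfSideSign p H v = c := hW v hvW hv
  -- `gradOutwardSign` is a constant `±1` along `O`; combine
  have key : ∀ d : ℤ, (d = 1 ∨ d = -1) → (∀ v' ∈ O, gradOutwardSign p O v' = d) →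
      complexOrientationSign p H O = 1 ∨ complexOrientationSign p H O = -1 := by
    intro d hd hgd
    have hall : ∀ v' ∈ O, complexOrientationSignAt p H O v' = c * d := fun v' hv' => by
      rw [complexOrientationSignAt, hhs v' hv', hcv, hgd v' hv']
    rw [complexOrientationSign_eq_of_forall ⟨v, hvO⟩ hall]
    rcases hc with rfl | rfl <;> rcases hd with rfl | rfl <;> norm_num
  rcases gradOutwardSign_eq_one_or_eq_neg_one_on_oval p hcpt hreg hv with hg | hg
  · exact key 1 (Or.inl rfl) hg
  · exact key (-1) (Or.inr rfl) hg

end Literature.AlgebraicGeometry.RealAlgebraic
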